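import Literature.NumberTheory.QuadraticForms.IntegralFramesIsotropy
import Literature.NumberTheory.QuadraticForms.MeyerRat
import HarnessLib

/-!
# Indefinite unimodular integral forms represent zero: local data and ranks `3`, `4`
# (Serre V §3.1 (ii), (iii))

Topic `NumberTheory/QuadraticForms`; namespace `Literature.NumberTheory.QuadraticForms`. Everything
here is proved.

Let `G` be a symmetric integer matrix with `det G = ±1` (a unimodular lattice in a basis) and
`f` an integral orthogonal frame with squares `dᵢ` (`IntegralFramesOdd.lean`; over `ℚ`, `ᵗxGy ≅
⟨d₁, …, dₙ⟩`). Serre, *A Course in Arithmetic*, Ch. V §3.1, proof of Thm. 3: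

* `exists_diag_zero_adicCompletion_of_odd` — *(ii) "`f` represents `0` in all the `ℚ_p`,
  `p ≠ 2`"*: for `n ≥ 3` and every finite place `v ∤ 2`, `⟨d⟩` has a non-trivial zero in `ℚ_v`
  (the `p`-adically unimodular frame at the prime under `v` is a unit form, isotropic by
  `exists_ternary_unit_zero`, and isotropy passes between frames,
  `exists_diag_zero_of_exists_diag_zero`);
* `exists_diag_zero_rat_three` — *(ii), `n = 3`*: by Hasse–Minkowski for `n = 3` in the strong
  form omitting the dyadic place (`exists_ternary_zero_rat_of_odd_places`, Serre IV §3.3 Cor. 3);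
* the dyadic datum in rank `4` (`exists_ratSign_two_data_four`) — *(iii)*: if `d(E) = -1` the
  characters `(·, -d₀d₁)_2`, `(·, -d₂d₃)_2` differ by `(·, -1)_2 ≠ 1` and take the required pair of
  values jointly (this replaces Serre's appeal to Thm. 6: "`d(E)` is not a square in `ℚ_2` … `f`
  represents `0` in `ℚ_2`"); if `d(E) = 1` the two characters agree and the required values agree
  by the product formula (Serre's Cor. 3 for `n = 4`, `d = 1`);
* `exists_diag_zero_rat_four` — *(iii), `n = 4`*: by Hasse–Minkowski for `n = 4` in symbol form
  (`exists_common_binary_value_rat`).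

Rank `≥ 5` (Meyer) and the assembly are in `UnimodularIsotropy.lean`.

## References

* J.-P. Serre, *A Course in Arithmetic*, GTM 7, Springer 1973, Ch. V §3.1 (PDF pp. 56–57),
  Ch. IV §3.2 Thm. 8, §3.3 Cor. 3. [Serre1973]
-/

noncomputable section

open IsDedekindDomain NumberField Rat.HeightOneSpectrum Finset Matrix

namespace Literature.NumberTheory.QuadraticForms

variable {n : ℕ} {G : Matrix (Fin n) (Fin n) ℤ}

/-- `det G = ±1` is prime to every prime. [folklore] -/
theorem not_dvd_det_of_isUnit (hdet : IsUnit G.det) {p : ℕ} (hp : p.Prime) : ¬ (p : ℤ) ∣ G.det := by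
  intro h
  have h1 : (p : ℤ) ∣ 1 := by
    rcases Int.isUnit_iff.1 hdet with h' | h' <;> rw [h'] at h
    · exact h
    · rwa [dvd_neg] at h
  exact hp.ne_one (by exact_mod_cast Int.eq_one_of_dvd_one (by positivity) h1)

/-- **Serre V §3.1 (ii): an integral orthogonal diagonalisation of a unimodular lattice of rank
`≥ 3` represents `0` in every `ℚ_v`, `v ∤ 2`.** For `v` over the odd prime `q`, the `q`-adically
unimodular frame (`exists_orthogonalFamily_not_dvd`) has unit squares, its first three give a zero
in `ℚ_v` (`exists_ternary_unit_zero`), and the zero is transported to the frame `f`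
(`exists_diag_zero_of_exists_diag_zero`). [cite: Serre1973, Ch. V §3.1] -/
theorem exists_diag_zero_adicCompletion_of_odd (hn : 3 ≤ n) (hG : G.IsSymm) (hdet : IsUnit G.det)
    {f : Fin n → (Fin n → ℤ)} (hfo : ∀ i j, i ≠ j → Matrix.toBilin' G (f i) (f j) = 0)
    (hfn : ∀ i, Matrix.toBilin' G (f i) (f i) ≠ 0) (v : HeightOneSpectrum (𝓞 ℚ))
    (hv : natGenerator v ≠ 2) :
    ∃ w : Fin n → v.adicCompletion ℚ, w ≠ 0 ∧
      ∑ i, (Matrix.toBilin' G (f i) (f i) : v.adicCompletion ℚ) * w i ^ 2 = 0 := by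
  obtain ⟨m, rfl⟩ := Nat.exists_eq_add_of_le hn
  haveI := Fact.mk (prime_natGenerator v)
  haveI : CharZero (v.adicCompletion ℚ) :=
    charZero_of_injective_algebraMap (algebraMap ℚ _).injective
  obtain ⟨g, hgo, hgu⟩ := exists_orthogonalFamily_not_dvd (p := natGenerator v) hv hG
    (not_dvd_det_of_isUnit hdet (prime_natGenerator v))
  have hgn : ∀ i, Matrix.toBilin' G (g i) (g i) ≠ 0 := fun i h ↦ hgu i (h ▸ dvd_zero _)
  refine exists_diag_zero_of_exists_diag_zero hgo hgn hfo hfn ?_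
  -- a zero of the unit ternary form `⟨e₀, e₁, e₂⟩`
  obtain ⟨X, Y, Z, hZ, hXYZ⟩ := exists_ternary_unit_zero v hv (hgu (Fin.castAdd m 0))
    (hgu (Fin.castAdd m 1)) (hgu (Fin.castAdd m 2))
  refine ⟨Fin.append ![X, Y, Z] 0, fun h0 ↦ hZ ?_, ?_⟩
  · have := congrFun h0 (Fin.castAdd m 2)
    simpa [Fin.append_left] using this
  · rw [Fin.sum_univ_add]
    simp only [Fin.append_left, Fin.append_right, Pi.zero_apply, ne_eq, OfNat.ofNat_ne_zero,
      not_false_eq_true, zero_pow, mul_zero, Finset.sum_const_zero, add_zero, Fin.sum_univ_three,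
      Matrix.cons_val_zero, Matrix.cons_val_one, Matrix.cons_val]
    simpa only [map_intCast] using hXYZ

/-! ### Rank `3` -/

/-- **Serre V §3.1 (ii), `n = 3`: an integral orthogonal diagonalisation `⟨d₀, d₁, d₂⟩` of an
indefinite unimodular lattice of rank `3` represents `0` over `ℚ`.** `f` represents `0` in all
`ℚ_v`, `v ∤ 2` (`exists_diag_zero_adicCompletion_of_odd`), and in `ℝ`; by Cor. 3 to the
Hasse–Minkowski theorem (the case `n = 3` omitting one place,
`exists_ternary_zero_rat_of_odd_places`) it represents `0` in `ℚ`. [cite: Serre1973, Ch. V §3.1] -/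
theorem exists_diag_zero_rat_three {G : Matrix (Fin 3) (Fin 3) ℤ} (hG : G.IsSymm)
    (hdet : IsUnit G.det) {f : Fin 3 → (Fin 3 → ℤ)}
    (hfo : ∀ i j, i ≠ j → Matrix.toBilin' G (f i) (f j) = 0)
    (hfn : ∀ i, Matrix.toBilin' G (f i) (f i) ≠ 0)
    (hneg : ∃ i, Matrix.toBilin' G (f i) (f i) < 0) (hpos : ∃ i, 0 < Matrix.toBilin' G (f i) (f i)) :
    ∃ z : Fin 3 → ℚ, z ≠ 0 ∧ ∑ i, (Matrix.toBilin' G (f i) (f i) : ℚ) * z i ^ 2 = 0 := by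
  set d : Fin 3 → ℤ := fun i ↦ Matrix.toBilin' G (f i) (f i) with hd
  have hd0 : ∀ i, (d i : ℚ) ≠ 0 := fun i ↦ by exact_mod_cast hfn i
  -- the ternary form `Z² - (-d₀d₂) X² - (-d₁d₂) Y²`
  have ha : (-(d 0 * d 2 : ℚ)) ≠ 0 := neg_ne_zero.2 (mul_ne_zero (hd0 0) (hd0 2))
  have hb : (-(d 1 * d 2 : ℚ)) ≠ 0 := neg_ne_zero.2 (mul_ne_zero (hd0 1) (hd0 2))
  -- local zeros at `v ∤ 2`
  have hloc : ∀ v : HeightOneSpectrum (𝓞 ℚ), natGenerator v ≠ 2 →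
      ∃ X Y Z : v.adicCompletion ℚ, (X ≠ 0 ∨ Y ≠ 0 ∨ Z ≠ 0) ∧
        Z ^ 2 - algebraMap ℚ _ (-(d 0 * d 2 : ℚ)) * X ^ 2 - algebraMap ℚ _ (-(d 1 * d 2 : ℚ)) * Y ^ 2 = 0 := by
    intro v hv
    obtain ⟨w, hw0, hw⟩ := exists_diag_zero_adicCompletion_of_odd le_rfl hG hdet hfo hfn v hv
    refine ⟨w 0, w 1, algebraMap ℚ _ (d 2 : ℚ) * w 2, ?_, ?_⟩
    · by_contra hall
      push Not at hall
      obtain ⟨h0, h1, h2⟩ := hall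
      haveI : CharZero (v.adicCompletion ℚ) :=
        charZero_of_injective_algebraMap (algebraMap ℚ _).injective
      have hd2 : ((d 2 : ℤ) : v.adicCompletion ℚ) ≠ 0 := Int.cast_ne_zero.2 (hfn 2)
      rw [map_intCast] at h2
      have hw2 : w 2 = 0 := (mul_eq_zero.1 h2).resolve_left hd2
      apply hw0
      ext i; fin_cases i <;> simp [h0, h1, hw2]
    · rw [Fin.sum_univ_three] at hw
      simp only [map_neg, map_mul, map_intCast] at hw ⊢
      linear_combination (d 2 : v.adicCompletion ℚ) * hw
  -- the real place: `-d₀d₂ > 0` or `-d₁d₂ > 0`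
  have hinf : (0 : ℚ) < -(d 0 * d 2 : ℚ) ∨ (0 : ℚ) < -(d 1 * d 2 : ℚ) := by
    rcases lt_or_gt_of_ne (hd0 2) with h2 | h2
    · obtain ⟨j, hj⟩ := hpos
      have hjv : j.val = 0 ∨ j.val = 1 ∨ j.val = 2 := by omega
      rcases hjv with h | h | h
      · have hj0 : j = 0 := Fin.ext h
        subst hj0
        have hj' : (0 : ℚ) < d 0 := by exact_mod_cast hj
        exact Or.inl (by nlinarith)
      · have hj1 : j = 1 := Fin.ext h
        subst hj1
        have hj' : (0 : ℚ) < d 1 := by exact_mod_cast hj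
        exact Or.inr (by nlinarith)
      · have hj2 : j = 2 := Fin.ext h
        subst hj2
        have hj' : (0 : ℚ) < d 2 := by exact_mod_cast hj
        exact absurd h2 (not_lt.2 hj'.le)
    · obtain ⟨i, hi⟩ := hneg
      have hiv : i.val = 0 ∨ i.val = 1 ∨ i.val = 2 := by omega
      rcases hiv with h | h | h
      · have hi0 : i = 0 := Fin.ext h
        subst hi0
        have hi' : (d 0 : ℚ) < 0 := by exact_mod_cast hi
        exact Or.inl (by nlinarith)
      · have hi1 : i = 1 := Fin.ext h
        subst hi1
        have hi' : (d 1 : ℚ) < 0 := by exact_mod_cast hi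
        exact Or.inr (by nlinarith)
      · have hi2 : i = 2 := Fin.ext h
        subst hi2
        have hi' : (d 2 : ℚ) < 0 := by exact_mod_cast hi
        exact absurd h2 (not_lt.2 hi'.le)
  obtain ⟨x, y, z, hz, hxyz⟩ := exists_ternary_zero_rat_of_odd_places ha hb hloc hinf
  -- the rational zero `(d₂ x, d₂ y, z)` of `⟨d₀, d₁, d₂⟩`
  refine ⟨![d 2 * x, d 2 * y, z], fun h ↦ hz (by simpa using congrFun h 2), ?_⟩
  rw [Fin.sum_univ_three]
  simp only [Matrix.cons_val_zero, Matrix.cons_val_one, Matrix.cons_val]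
  change (d 0 : ℚ) * (d 2 * x) ^ 2 + (d 1 : ℚ) * (d 2 * y) ^ 2 + (d 2 : ℚ) * z ^ 2 = 0
  linear_combination (d 2 : ℚ) * hxyz

end Literature.NumberTheory.QuadraticForms
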